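import Summits.Ventures.PercRepro.SixFourT4Identity
import Summits.Ventures.PercRepro.SixFourT3

/-!
# PercRepro — C-025 at `(6,4)`, §22.7, part A: line profiles of a plane trace and the bound `5·D₃ ≤ 14·t` (p3, gen 8)

mine-2's `MINE2-RLS.md` §22.7 uses «over the 39 types `D₃(τ) ≤ (14/5)·t(τ)`» for every plane trace `τ` with at most
`7` points (`t(τ)` = the independent triples of `τ`).  Here the bound is proved WITHOUT the type classification: for a
rank-`3` set `ρ` the lines of `M` partition its pairs (`sum_choose_two_trace`), two distinct lines share at most one
point of `ρ` (`card_inter_le_one_of_ne`), and `D₃(ρ) = δ(p) − Σ_ℓ δ(m_ℓ)`, `t(ρ) = C(p,3) − Σ_ℓ C(m_ℓ,3)` with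
`m_ℓ = |ℓ ∩ ρ|` (`D3_add_sum_delta`, `t_add_sum_choose_three`).  With `inc_m` := the number of lines meeting `ρ` in
exactly `m` points these are linear in the profile `(p, inc₂, …, inc₆)`, and the inequality becomes a finite check
over the profiles with `Σ_m C(m,2)·inc_m = C(p,2)`, `inc_m = 0` for `m ≥ p`, and the line-meeting constraints
`m + m′ − 1 ≤ p` (`profile_cert`, by `decide`: `43` profiles with `p ≤ 7`, equality only at the `6`-line + point plane,
`42 = (14/5)·15`).  Main result: `five_D3_le_fourteen_t` — for every plane `P` with `|P ∩ G| ≤ 7` and `r(P ∩ G) = 3`,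
`5·D3 M G P ≤ 14·#indepTriples M (P ∩ G)`.
-/

namespace PercRepro.SixFour

open Finset ThmH

variable {α : Type*} [DecidableEq α] {M : Matroid α} [M.Finite]

/-! ## Lines on a point set: pairs are partitioned, two lines share at most one point -/

/-- Two distinct lines share at most one point. -/
theorem card_inter_le_one_of_ne (hs : Simple M) {L L' : Finset α} (hL : L ∈ lines M) (hL' : L' ∈ lines M)
    (hne : L ≠ L') : (L ∩ L').card ≤ 1 := by
  by_contra h
  obtain ⟨a, ha, b, hb, hab⟩ := Finset.one_lt_card.1 (by omega : 1 < (L ∩ L').card)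
  exact hne (lines_eq_of_two_mem hs hL hL' (Finset.mem_inter.1 ha).1 (Finset.mem_inter.1 hb).1
    (Finset.mem_inter.1 ha).2 (Finset.mem_inter.1 hb).2 hab)

/-- The `k`-subsets (`k ≥ 2`) of `ρ` of rank `2` whose closure is the line `L` are the `k`-subsets of `L ∩ ρ`. -/
theorem fiberk_line_eq (hs : Simple M) {ρ : Finset α} (hρ : ρ ⊆ gr M) {L : Finset α} (hL : L ∈ lines M) {k : ℕ}
    (hk : 2 ≤ k) :
    ((ρ.powersetCard k).filter (fun Z : Finset α => M.eRk (Z : Set α) = 2)).filter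
      (fun Z : Finset α => clF M Z = L) = (L ∩ ρ).powersetCard k := by
  ext Z
  simp only [Finset.mem_filter, Finset.mem_powersetCard]
  constructor
  · rintro ⟨⟨⟨hZρ, hc⟩, -⟩, hcl⟩
    refine ⟨Finset.subset_inter ?_ hZρ, hc⟩
    rw [← hcl, ← Finset.coe_subset, coe_clF]
    exact M.subset_closure _ (by rw [← coe_gr M]; exact Finset.coe_subset.2 (hZρ.trans hρ))
  · rintro ⟨hZ, hc⟩
    have hr := eRk_eq_two_of_subset_line hs hL (hZ.trans Finset.inter_subset_left) (by omega)
    refine ⟨⟨⟨hZ.trans Finset.inter_subset_right, hc⟩, hr⟩, ?_⟩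
    apply Finset.coe_injective
    rw [coe_clF]
    exact closure_eq_of_subset_line hL (hZ.trans Finset.inter_subset_left) hr

/-- The rank-`2` `k`-subsets of `ρ` (`k ≥ 2`) number `Σ_ℓ C(|ℓ ∩ ρ|, k)`. -/
theorem card_rank_two_subsets (hs : Simple M) {ρ : Finset α} (hρ : ρ ⊆ gr M) {k : ℕ} (hk : 2 ≤ k) :
    ((ρ.powersetCard k).filter (fun Z : Finset α => M.eRk (Z : Set α) = 2)).card =
      ∑ L ∈ lines M, (L ∩ ρ).card.choose k := by
  rw [Finset.card_eq_sum_card_fiberwise (f := fun Z => clF M Z) (t := lines M) (fun Z hZ => by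
    rw [Finset.mem_coe, Finset.mem_filter, Finset.mem_powersetCard] at hZ
    exact Finset.mem_coe.2 (clF_mem_lines (hZ.1.1.trans hρ) hZ.2).1)]
  exact Finset.sum_congr rfl (fun L hL => by rw [fiberk_line_eq hs hρ hL hk, Finset.card_powersetCard])

/-- The pairs of `ρ` are partitioned by the lines: `Σ_ℓ C(|ℓ ∩ ρ|, 2) = C(|ρ|, 2)`. -/
theorem sum_choose_two_trace (hs : Simple M) {ρ : Finset α} (hρ : ρ ⊆ gr M) :
    ∑ L ∈ lines M, (L ∩ ρ).card.choose 2 = ρ.card.choose 2 := by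
  rw [← card_rank_two_subsets hs hρ (le_refl 2), Finset.filter_true_of_mem, Finset.card_powersetCard]
  intro Z hZ
  obtain ⟨hZρ, hc⟩ := Finset.mem_powersetCard.1 hZ
  obtain ⟨a, ha, b, hb, hab⟩ := Finset.one_lt_card.1 (by omega : 1 < Z.card)
  refine le_antisymm ?_ (two_le_eRk_of_two_mem hs (hZρ.trans hρ) ha hb hab)
  have := M.eRk_le_encard (Z : Set α)
  rw [Set.encard_coe_eq_coe_finsetCard, hc] at this
  exact this

/-! ## `D₃` and `t` of a rank-`3` set in terms of its line profile -/

/-- For a rank-`3` set `ρ`: `#{Z ⊆ ρ : |Z| ≥ 4, r(Z) = 3} + Σ_ℓ δ(|ℓ ∩ ρ|) = δ(|ρ|)`. -/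
theorem D3_add_sum_delta (hs : Simple M) {ρ : Finset α} (hρ : ρ ⊆ gr M) (hr : M.eRk (ρ : Set α) = 3) :
    (ρ.powerset.filter (fun Z : Finset α => 4 ≤ Z.card ∧ M.eRk (Z : Set α) = 3)).card +
      ∑ L ∈ lines M, delta (L ∩ ρ).card = delta ρ.card := by
  rw [← card_powerset_filter_four_le]
  have hsplit := Finset.card_filter_add_card_filter_not (s := ρ.powerset.filter (fun Z : Finset α => 4 ≤ Z.card))
    (fun Z : Finset α => M.eRk (Z : Set α) = 3)
  rw [Finset.filter_filter, Finset.filter_filter] at hsplit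
  have e2 : ρ.powerset.filter (fun Z : Finset α => 4 ≤ Z.card ∧ ¬ M.eRk (Z : Set α) = 3) =
      ρ.powerset.filter (fun Z : Finset α => 4 ≤ Z.card ∧ M.eRk (Z : Set α) = 2) := by
    refine Finset.filter_congr (fun Z hZ => ?_)
    rw [Finset.mem_powerset] at hZ
    have hle : M.eRk (Z : Set α) ≤ 3 := by rw [← hr]; exact M.eRk_mono (Finset.coe_subset.2 hZ)
    constructor
    · rintro ⟨h4, hne⟩
      refine ⟨h4, le_antisymm ?_ (two_le_eRk_of_two_le_card hs hρ hZ (by omega))⟩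
      by_contra h
      exact hne (eRk_eq_of_le_of_not_le (n := 2) hle h)
    · rintro ⟨h4, h2⟩
      exact ⟨h4, by rw [h2]; decide⟩
  rw [e2] at hsplit
  have hln : (ρ.powerset.filter (fun Z : Finset α => 4 ≤ Z.card ∧ M.eRk (Z : Set α) = 2)).card =
      ∑ L ∈ lines M, delta (L ∩ ρ).card := by
    rw [Finset.card_eq_sum_card_fiberwise (f := fun Z => clF M Z) (t := lines M) (fun Z hZ => by
      rw [Finset.mem_coe, Finset.mem_filter, Finset.mem_powerset] at hZ
      exact Finset.mem_coe.2 (clF_mem_lines (hZ.1.trans hρ) hZ.2.2).1)]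
    exact Finset.sum_congr rfl (fun L hL => by rw [fiber_line_eq hs hρ hL, card_powerset_filter_four_le])
  omega

/-- For a rank-`3` set `ρ`: `#indepTriples ρ + Σ_ℓ C(|ℓ ∩ ρ|, 3) = C(|ρ|, 3)`. -/
theorem t_add_sum_choose_three (hs : Simple M) {ρ : Finset α} (hρ : ρ ⊆ gr M) (hr : M.eRk (ρ : Set α) = 3) :
    (indepTriples M ρ).card + ∑ L ∈ lines M, (L ∩ ρ).card.choose 3 = ρ.card.choose 3 := by
  rw [← card_rank_two_subsets hs hρ (by norm_num : 2 ≤ 3), ← Finset.card_powersetCard 3 ρ]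
  unfold indepTriples
  have hcongr : (ρ.powersetCard 3).filter (fun Z : Finset α => M.eRk (Z : Set α) = 2) =
      (ρ.powersetCard 3).filter (fun Z : Finset α => ¬ M.eRk (Z : Set α) = 3) := by
    refine Finset.filter_congr (fun Z hZ => ?_)
    obtain ⟨hZρ, hc⟩ := Finset.mem_powersetCard.1 hZ
    have hle : M.eRk (Z : Set α) ≤ 3 := by rw [← hr]; exact M.eRk_mono (Finset.coe_subset.2 hZρ)
    constructor
    · intro h2; rw [h2]; decide
    · intro hne
      refine le_antisymm ?_ (two_le_eRk_of_two_le_card hs hρ hZρ (by omega))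
      by_contra h
      exact hne (eRk_eq_of_le_of_not_le (n := 2) hle h)
  rw [hcongr, Finset.card_filter_add_card_filter_not]

/-! ## The profile: `inc_m` lines meeting `ρ` in `m` points -/

/-- `inc ρ m`: the number of lines of `M` meeting `ρ` in exactly `m` points. -/
noncomputable def inc (M : Matroid α) [M.Finite] (ρ : Finset α) (m : ℕ) : ℕ :=
  ((lines M).filter (fun L : Finset α => (L ∩ ρ).card = m)).card

/-- A sum over the lines of a function of `|ℓ ∩ ρ|` is a sum over the profile. -/
theorem sum_lines_eq_sum_inc (ρ : Finset α) (f : ℕ → ℕ) :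
    ∑ L ∈ lines M, f (L ∩ ρ).card = ∑ m ∈ Finset.range (ρ.card + 1), inc M ρ m * f m := by
  rw [← Finset.sum_fiberwise_of_maps_to' (g := fun L : Finset α => (L ∩ ρ).card) (t := Finset.range (ρ.card + 1))
    (fun L _ => by rw [Finset.mem_range]; exact Nat.lt_succ_of_le (Finset.card_le_card Finset.inter_subset_right))]
  refine Finset.sum_congr rfl (fun m _ => ?_)
  rw [Finset.sum_const, smul_eq_mul]
  rfl

/-- No line meets a rank-`3` set `ρ` in `|ρ|` (or more) points. -/
theorem inc_eq_zero_of_card_le {ρ : Finset α} (hr : M.eRk (ρ : Set α) = 3) {m : ℕ} (hm : ρ.card ≤ m) :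
    inc M ρ m = 0 := by
  unfold inc
  rw [Finset.card_eq_zero, Finset.filter_false_of_mem]
  intro L hL hc
  have hsub : ρ ⊆ L := by
    have := Finset.eq_of_subset_of_card_le (Finset.inter_subset_right (s₁ := L) (s₂ := ρ)) (by omega)
    rw [← this]; exact Finset.inter_subset_left
  have := M.eRk_mono (Finset.coe_subset.2 hsub)
  rw [hr, (mem_lines.1 hL).2.2] at this
  exact absurd this (by decide)

/-- `C(m,2)·inc_m ≤ C(p,2)` for every `m` (the pairs on the `m`-lines are among the pairs of `ρ`). -/
theorem choose_two_mul_inc_le (hs : Simple M) {ρ : Finset α} (hρ : ρ ⊆ gr M) (m : ℕ) :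
    m.choose 2 * inc M ρ m ≤ ρ.card.choose 2 := by
  rw [← sum_choose_two_trace hs hρ]
  unfold inc
  rw [Finset.card_eq_sum_ones, Finset.mul_sum, mul_one, Finset.sum_filter]
  refine Finset.sum_le_sum (fun L _ => ?_)
  split_ifs with h
  · rw [h]
  · exact Nat.zero_le _

/-- Two lines meeting `ρ` in `m` and `m′` points (distinct lines) satisfy `m + m′ ≤ |ρ| + 1`. -/
theorem add_le_of_two_lines (hs : Simple M) {ρ L L' : Finset α} (hL : L ∈ lines M) (hL' : L' ∈ lines M)
    (hne : L ≠ L') : (L ∩ ρ).card + (L' ∩ ρ).card ≤ ρ.card + 1 := by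
  have h1 := Finset.card_union_add_card_inter (L ∩ ρ) (L' ∩ ρ)
  have h2 : (L ∩ ρ ∪ L' ∩ ρ).card ≤ ρ.card :=
    Finset.card_le_card (Finset.union_subset Finset.inter_subset_right Finset.inter_subset_right)
  have h3 : ((L ∩ ρ) ∩ (L' ∩ ρ)).card ≤ 1 := by
    refine (Finset.card_le_card ?_).trans (card_inter_le_one_of_ne hs hL hL' hne)
    intro x hx
    simp only [Finset.mem_inter] at hx ⊢
    exact ⟨hx.1.1, hx.2.1⟩
  omega

/-- If `inc_m ≥ 1` and `inc_{m′} ≥ 1` with `m ≠ m′` then `m + m′ ≤ |ρ| + 1`. -/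
theorem add_le_of_inc_pos (hs : Simple M) {ρ : Finset α} {m m' : ℕ} (hmm : m ≠ m') (h1 : 1 ≤ inc M ρ m)
    (h2 : 1 ≤ inc M ρ m') : m + m' ≤ ρ.card + 1 := by
  unfold inc at h1 h2
  obtain ⟨L, hL⟩ := Finset.card_pos.1 h1
  obtain ⟨L', hL'⟩ := Finset.card_pos.1 h2
  rw [Finset.mem_filter] at hL hL'
  have hne : L ≠ L' := fun h => hmm (by rw [← hL.2, ← hL'.2, h])
  have := add_le_of_two_lines hs (ρ := ρ) hL.1 hL'.1 hne
  omega

/-- If `inc_m ≥ 2` then `2m ≤ |ρ| + 1`. -/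
theorem two_mul_le_of_two_le_inc (hs : Simple M) {ρ : Finset α} {m : ℕ} (h2 : 2 ≤ inc M ρ m) :
    2 * m ≤ ρ.card + 1 := by
  unfold inc at h2
  obtain ⟨L, hL, L', hL', hne⟩ := Finset.one_lt_card.1 (by omega : 1 < ((lines M).filter
    (fun L : Finset α => (L ∩ ρ).card = m)).card)
  rw [Finset.mem_filter] at hL hL'
  have := add_le_of_two_lines hs (ρ := ρ) hL.1 hL'.1 hne
  rw [hL.2, hL'.2] at this
  omega

/-! ## The finite certificate -/

/-- The constraints on a line profile `(p, i₃, i₄, i₅, i₆)` of a rank-`3` set with `p` points (`i_m` = lines meeting it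
in `m` points): the pairs on the `≥ 3`-lines are among the `C(p,2)` pairs, no line has `≥ p` points, two lines share at
most one point (`m + m′ ≤ p + 1`, `2m ≤ p + 1` for two lines of the same size). -/
def ProfileCons (p i3 i4 i5 i6 : ℕ) : Prop :=
  3 * i3 + 6 * i4 + 10 * i5 + 15 * i6 ≤ p.choose 2 ∧
  (p ≤ 3 → i3 = 0) ∧ (p ≤ 4 → i4 = 0) ∧ (p ≤ 5 → i5 = 0) ∧ (p ≤ 6 → i6 = 0) ∧
  (1 ≤ i3 → 1 ≤ i4 → 7 ≤ p + 1) ∧ (1 ≤ i3 → 1 ≤ i5 → 8 ≤ p + 1) ∧ (1 ≤ i3 → 1 ≤ i6 → 9 ≤ p + 1) ∧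
  (1 ≤ i4 → 1 ≤ i5 → 9 ≤ p + 1) ∧ (1 ≤ i4 → 1 ≤ i6 → 10 ≤ p + 1) ∧ (1 ≤ i5 → 1 ≤ i6 → 11 ≤ p + 1) ∧
  (2 ≤ i3 → 6 ≤ p + 1) ∧ (2 ≤ i4 → 8 ≤ p + 1) ∧ (2 ≤ i5 → 10 ≤ p + 1) ∧ (2 ≤ i6 → 12 ≤ p + 1)

/-- `ProfileCons` is decidable. -/
instance (p i3 i4 i5 i6 : ℕ) : Decidable (ProfileCons p i3 i4 i5 i6) := by unfold ProfileCons; infer_instance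

/-- The profile inequality `5·δ(p) + 14·Σ_m C(m,3)·i_m ≤ 14·C(p,3) + 5·Σ_m δ(m)·i_m` (`δ(4), δ(5), δ(6) = 1, 6, 22`;
`C(3,3), …, C(6,3) = 1, 4, 10, 20`), i.e. `5·D₃ ≤ 14·t` in profile form. -/
def ProfileIneq (p i3 i4 i5 i6 : ℕ) : Prop :=
  5 * delta p + 14 * (i3 * 1 + i4 * 4 + i5 * 10 + i6 * 20) ≤
    14 * p.choose 3 + 5 * (i4 * 1 + i5 * 6 + i6 * 22)

/-- `ProfileIneq` is decidable. -/
instance (p i3 i4 i5 i6 : ℕ) : Decidable (ProfileIneq p i3 i4 i5 i6) := by unfold ProfileIneq; infer_instance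

/-- The finite check (`1536` profile vectors, `43` of them satisfying the constraints), by `decide`. -/
theorem profile_cert_bool : ∀ p < 8, ∀ i3 < 8, ∀ i4 < 4, ∀ i5 < 3, ∀ i6 < 2,
    (!decide (ProfileCons p i3 i4 i5 i6) || decide (ProfileIneq p i3 i4 i5 i6)) = true := by
  decide

/-- The certificate in `Prop` form. -/
theorem profile_cert {p i3 i4 i5 i6 : ℕ} (hp : p < 8) (h3 : i3 < 8) (h4 : i4 < 4) (h5 : i5 < 3) (h6 : i6 < 2)
    (hc : ProfileCons p i3 i4 i5 i6) : ProfileIneq p i3 i4 i5 i6 := by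
  have h := profile_cert_bool p hp i3 h3 i4 h4 i5 h5 i6 h6
  rw [Bool.or_eq_true, Bool.not_eq_true', decide_eq_false_iff_not, decide_eq_true_eq] at h
  exact h.resolve_left (not_not.2 hc)

/-! ## The bridge: `5·D₃(ρ) ≤ 14·t(ρ)` for every rank-`3` set with at most `7` points -/

/-- `δ(0) = δ(1) = δ(2) = δ(3) = 0`, `δ(4) = 1`, `δ(5) = 6`, `δ(6) = 22`. -/
theorem delta_values : delta 0 = 0 ∧ delta 1 = 0 ∧ delta 2 = 0 ∧ delta 3 = 0 ∧ delta 4 = 1 ∧ delta 5 = 6 ∧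
    delta 6 = 22 := by
  decide

/-- The small binomial coefficients used in the profile sums. -/
theorem choose_values : Nat.choose 1 2 = 0 ∧ Nat.choose 2 2 = 1 ∧ Nat.choose 3 2 = 3 ∧ Nat.choose 4 2 = 6 ∧
    Nat.choose 5 2 = 10 ∧ Nat.choose 6 2 = 15 ∧ Nat.choose 7 2 = 21 ∧ Nat.choose 1 3 = 0 ∧ Nat.choose 2 3 = 0 ∧
    Nat.choose 3 3 = 1 ∧ Nat.choose 4 3 = 4 ∧ Nat.choose 5 3 = 10 ∧ Nat.choose 6 3 = 20 ∧ Nat.choose 7 3 = 35 := by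
  decide

/-- A profile sum over `range (p + 1)` with `p ≤ 7` is the sum over `range 8` (`inc_m = 0` for `m ≥ p`). -/
theorem sum_inc_range_eight {ρ : Finset α} (hr : M.eRk (ρ : Set α) = 3) (h7 : ρ.card ≤ 7) (f : ℕ → ℕ) :
    ∑ m ∈ Finset.range (ρ.card + 1), inc M ρ m * f m = ∑ m ∈ Finset.range 8, inc M ρ m * f m := by
  refine Finset.sum_subset (fun m hm => by rw [Finset.mem_range] at hm ⊢; omega) (fun m hm hnm => ?_)
  rw [Finset.mem_range] at hm hnm
  rw [inc_eq_zero_of_card_le hr (by omega), zero_mul]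

/-- **`5·D₃ ≤ 14·t`** for every plane `P` whose trace `P ∩ G` has rank `3` and at most `7` points. -/
theorem five_D3_le_fourteen_t (hs : Simple M) {G : Finset α} (hG : G ⊆ gr M) {P : Finset α}
    (h7 : (P ∩ G).card ≤ 7) (hr : M.eRk ((P ∩ G : Finset α) : Set α) = 3) :
    5 * D3 M G P ≤ 14 * (indepTriples M (P ∩ G)).card := by
  set ρ := P ∩ G with hρdef
  have hρ : ρ ⊆ gr M := Finset.inter_subset_right.trans hG
  obtain ⟨d0, d1, d2, d3, d4, d5, d6⟩ := delta_values
  obtain ⟨c12, c22, c32, c42, c52, c62, c72, c13, c23, c33, c43, c53, c63, c73⟩ := choose_values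
  -- the three profile sums
  have hD := D3_add_sum_delta hs hρ hr
  have ht := t_add_sum_choose_three hs hρ hr
  have hpair := sum_choose_two_trace hs hρ
  have eD := sum_lines_eq_sum_inc (M := M) ρ (fun n => delta n)
  have et := sum_lines_eq_sum_inc (M := M) ρ (fun n => n.choose 3)
  have ep := sum_lines_eq_sum_inc (M := M) ρ (fun n => n.choose 2)
  rw [eD, sum_inc_range_eight hr h7] at hD
  rw [et, sum_inc_range_eight hr h7] at ht
  rw [ep, sum_inc_range_eight hr h7] at hpair
  have hi7 : inc M ρ 7 = 0 := inc_eq_zero_of_card_le hr (by omega)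
  have hip : ∀ m, ρ.card ≤ m → inc M ρ m = 0 := fun m hm => inc_eq_zero_of_card_le hr hm
  simp only [Finset.sum_range_succ, Finset.sum_range_zero, d0, d1, d2, d3, d4, d5, d6, Nat.choose_zero_succ,
    c12, c22, c32, c42, c52, c62, c72, c13, c23, c33, c43, c53, c63, c73, hi7, mul_zero, zero_add, mul_one,
    zero_mul, add_zero] at hD ht hpair
  -- the bounds on the profile
  have hb3 := choose_two_mul_inc_le hs hρ 3
  have hb4 := choose_two_mul_inc_le hs hρ 4
  have hb5 := choose_two_mul_inc_le hs hρ 5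
  have hb6 := choose_two_mul_inc_le hs hρ 6
  have hc2 : ρ.card.choose 2 ≤ 21 := (Nat.choose_le_choose 2 h7).trans (by decide)
  rw [c32] at hb3
  rw [c42] at hb4
  rw [c52] at hb5
  rw [c62] at hb6
  have hcons : ProfileCons ρ.card (inc M ρ 3) (inc M ρ 4) (inc M ρ 5) (inc M ρ 6) := by
    refine ⟨?_, fun h => hip 3 h, fun h => hip 4 h, fun h => hip 5 h, fun h => hip 6 h, ?_, ?_, ?_, ?_, ?_, ?_,
      ?_, ?_, ?_, ?_⟩
    · omega
    · intro h1 h2; have := add_le_of_inc_pos hs (by norm_num : (3 : ℕ) ≠ 4) h1 h2; omega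
    · intro h1 h2; have := add_le_of_inc_pos hs (by norm_num : (3 : ℕ) ≠ 5) h1 h2; omega
    · intro h1 h2; have := add_le_of_inc_pos hs (by norm_num : (3 : ℕ) ≠ 6) h1 h2; omega
    · intro h1 h2; have := add_le_of_inc_pos hs (by norm_num : (4 : ℕ) ≠ 5) h1 h2; omega
    · intro h1 h2; have := add_le_of_inc_pos hs (by norm_num : (4 : ℕ) ≠ 6) h1 h2; omega
    · intro h1 h2; have := add_le_of_inc_pos hs (by norm_num : (5 : ℕ) ≠ 6) h1 h2; omega
    · intro h; have := two_mul_le_of_two_le_inc hs h; omega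
    · intro h; have := two_mul_le_of_two_le_inc hs h; omega
    · intro h; have := two_mul_le_of_two_le_inc hs h; omega
    · intro h; have := two_mul_le_of_two_le_inc hs h; omega
  have hineq := profile_cert (by omega) (by omega) (by omega) (by omega) (by omega) hcons
  unfold ProfileIneq at hineq
  show 5 * (ρ.powerset.filter (fun S : Finset α => 4 ≤ S.card ∧ M.eRk (S : Set α) = 3)).card ≤
    14 * (indepTriples M ρ).card
  omega

end PercRepro.SixFour
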